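import Literature.NumberTheory.Rogawski1990.U3PrincipalSeriesReducibility            -- ★ NF1 `KeysCaseTwo` :136 (the TARGET), `IrrClass.IsSquareIntegrable`
import Summits.HodgeConjecture.HodgeConjecture.Theorems.F0P3XiPacketFamilyOfRecord    -- ★ `isAdmissible_of_isConstituentOf`, (★ `isAdmissible_cmPrincipalSeries`), `Gqs`
import Literature.NumberTheory.Rogawski1990.KeysCaseTwoReducible                      -- ★ p826369 (typ-T3a): N4 LETTER `KeysCaseTwoReducible L` [Keys1984 §7 Thm (2)]
import Literature.NumberTheory.Automorphic.UnitaryGroupPrincipalSeriesExponents      -- ★ p825973 (typ-T3a): `cmWeylTorusCharPair` (= wχ), `HasJacquetExponent`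
import Literature.NumberTheory.Automorphic.CMXiTorusCharSplitTorusDecay             -- ★ p826744 (typ-T3b): S4∕S5 junction lemmas `norm_cmXiTorusChar_lt_one`, `exists_torusU_one_lt_norm_conj_inv`
import Literature.NumberTheory.Automorphic.U3PrincipalSeriesJacquetFiltration        -- ★ p826240 (typ-T3a): N1 `U3PrincipalSeriesJacquetFiltration L` [Casselman1995 L. 7.1.1 (a)] (BY NAME, ED. v5)
import Literature.NumberTheory.Automorphic.U3PrincipalSeriesLengthLeTwo              -- ★ p826287 (typ-T3a): N3 `U3PrincipalSeriesLengthLeTwo L` [Casselman1995 Cor. 7.1.2] (BY NAME, ED. v5)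
import Literature.NumberTheory.Automorphic.U3PrincipalSeriesSubrepSquareIntegrable   -- ★ p826314 (typ-T3a): N5′ `U3PrincipalSeriesSubrepSquareIntegrable L` [Casselman1995 Prop. 7.1.3] (BY NAME, ED. v5)
import Literature.NumberTheory.Automorphic.U3SquareIntegrableExponents               -- ★ p826342 (typ-T3a): N5 LETTER `U3SquareIntegrableExponents L` [Casselman1995 Thm. 4.4.6] (BY NAME, ED. v5)
import Literature.NumberTheory.Automorphic.JacquetExponentUnique                     -- ★ p827046 (A-p01 (g17)): glue G5 `HasJacquetExponent.eq_of_equiv_twist_trivial` (S3 junction, ED. v5)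
import Summits.HodgeConjecture.HodgeConjecture.Theorems.F0P3bCentralCharacterUnitaryNonsplit  -- ★ p827424 (A-p01 (g17)): glue G3 `exists_centralChar_norm_eq_one_of_nonsplit` (+ ★ p827334 generic) — CLOSES `stub_centralCharUnitary` (ED. v6)
import Literature.NumberTheory.Automorphic.U3PrincipalSeriesConstituentEmbeds           -- ★ p826667 (typ-T3a): N2 `U3PrincipalSeriesConstituentEmbeds L` [Casselman1995 Cor. 6.3.9 (b)] (BY NAME, ED. v7)
import Summits.HodgeConjecture.HodgeConjecture.Theorems.F0P3U3LengthLeTwoOfEmbeds            -- ★ p829972 (A-p01 (g18)): J1 «N3 ⇐ N1 + N2» `u3PrincipalSeriesLengthLeTwo_of_embeds` — CLOSES `stub_lengthLeTwo` modulo N1, N2 (ED. v7)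
import Summits.HodgeConjecture.HodgeConjecture.Theorems.F0P3U3SubrepSquareIntegrableOfExponents  -- ★ p830391 (A-p01 (g18)): J2 «N5′ ⇐ N5 + N1 + N2» — CLOSES `stub_subrepSquareIntegrable` modulo N5, N1, N2 (ED. v8)
import Summits.HodgeConjecture.HodgeConjecture.Theorems.F0P3U3PrincipalSeriesJacquetFiltrationHolds  -- ★ p832625 (B-p10 (g21), ED. 3 over ★ γ-W p831847 A-p13 (g27)): hypothesis-free N1 `U3PrincipalSeriesJacquetFiltration_holds L` — CLOSES `stub_jacquetFiltration` (registered ED. 3)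
import Summits.HodgeConjecture.HodgeConjecture.Theorems.F0P3U3ConstituentEmbedsOfJacquet             -- ★ p831765 (F0P3-p01 (g10)): «N2 ⇐ N1» `u3PrincipalSeriesConstituentEmbeds_of_jacquetFiltration` (N6 ★ inside) — CLOSES `stub_constituentEmbeds` modulo N1 (registered ED. 2)
import Summits.HodgeConjecture.HodgeConjecture.Theorems.F0P3KeysLabelledPair                     -- ★ F0P3-p02 (g8) p833040: S2 head `labelledPair_of_reducible (hN1 hN2 hN3) …` — CLOSES `stub_labelledPair_of_reducible`
import Summits.HodgeConjecture.HodgeConjecture.Theorems.F0P3U3PrincipalSeriesLettersHold   -- ★ p833019 (A-p01 (g18)): hypothesis-free N2 ∕ N3 ∕ N5′⇐N5 heads by name (s677 (3) tokens, ED. 4)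
import Summits.HodgeConjecture.HodgeConjecture.Theorems.F0P3U3SquareIntegrableExponentsHolds  -- ★ p834912 (F0P3-p01 (g10), N5 road R1–R6): hypothesis-free N5 `u3SquareIntegrableExponents_holds L` — CLOSES `stub_casselmanCriterion` (registered ED. 5)
import Literature.NumberTheory.GelbartRogawski1991.ThetaTypeNonsplitJacquetModule     -- ★ p826177 (typ): #96 LETTER `thetaType_nonsplit_jacquetModule` [GelbartRogawski1991 §3.2 (3.2.1)–(3.2.2); Kudla1986 Thm 2.8] — the NEW registered letter stub (ED. 6)
import Summits.HodgeConjecture.HodgeConjecture.Theorems.F0P3KeysCaseTwoReducibleOfN3  -- ★ p835809 (B-p14 (g28) FILE 3 over ★ B-p10 (1b) + road T): `keysCaseTwoReducible_of_N3 (L) (hN3) : KeysCaseTwoReducible L` — CLOSES `stub_keysCaseTwoReducible` modulo #96 (registered ED. 6)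
import Summits.HodgeConjecture.HodgeConjecture.Theorems.F0P2oLineJacquetHolds  -- ★ p839151 (F0P2-p06 (g4), road (N′) `…_of_lineJacquet lineJacquet_holds`): a CLOSED proof of the #96 letter `thetaType_nonsplit_jacquetModule` lives in this cone; FOLDS `stub_thetaTypeJacquetModule` (registered ED. 7 — the line is SORRY-FREE)
import HarnessLib

/-!
# LINE «KeysCaseTwo» PAY-DOWN — REGISTERED skeleton `Cruxes/H413/Lines/F0_P3_KeysCaseTwoPaydown.lean` (s554 format; typed by typ-T3b (g0), topic T3; pen F0P3b-plan; registered ED. 1 = commit a0e8e9e8306e, ED. 2 = N2 folded by ★ p831765 (70b06b0ea576), ED. 3 = N1 folded by ★ p832625 (3874e34b1ca9), ED. 4 = S2 folded by ★ p833040, ED. 5 = N5 folded by ★ p834912, ED. 6 = N4 folded by ★ p835809 over the #96 letter, ED. 7 = #96 folded by ★ p839151 — NO `sorry` LEFT: `keysCaseTwo_closed : KeysCaseTwoClosed` is a theorem of the tree (TRIO); sorry-free Theorems twin ★ p831694 `F0P3KeysCaseTwoOfStubs`)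

Cell `hodgecm-mathlib`, F0∕P3 «U3-mult», crux H413 (`stmt-HodgeConjecture-24833`).  Books row NF1 `Rogawski1990.KeysCaseTwo` (★ p802900, TYPED, UNPROVED;
consumed BY NAME by `stub_Keys : ∀ L …, KeysCaseTwo L` of the K9β closer, ED. 4 §C of `Lines/F0_U3LettersRung1.lean`).  Payability map: `F0/P3/T3b-TREE.md`
(sha16 02bb870a0fb0ac11) §2.  Twin typ-T3a (g0) types the tree's nodes N1–N5 as Literature files (CLAIM F0/P3/STATUS 14:34:24Z); the five stubs below
are the CONSUMER SHAPES of those nodes, and re-point to them by 3-line glue when they land (see «RE-POINTING» under each stub).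
HONEST LABEL: HC_CM is proved only modulo the printed citations («named inputs remaining 2») until rung 0 closes; this skeleton discharges NOTHING until
its stubs close, and even then S1 (Keys) and S3 (Casselman 4.4.6) REMAIN cited letters — the row NF1 is then READ as {Keys1984 §7 Thm (2), Casselman1995 Thm 4.4.6}.

THE PRINT.  [Rogawski1990] §12.2 pp. 173–174: «If `i_G(χ)` is reducible, it contains exactly two irreducible constituents ([BZ]). … `w(χ₁, χ₂) = (χ̄₁⁻¹, χ₂)`.
According to results of Keys ([Ky]), `i_G(χ)` is irreducible except … (2) `χ₁(α) = η(α)‖α‖^{1/2}` or `η(α)‖α‖^{-1/2}`, where `η|F^* = ω_{E/F}` … In case (2),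
`i_G(χ)` has a unique square-integrable constituent.»  [Keys1984] §7 p. 126: «By Theorem 6.6.2 of [Casselman], the non-unitary principal series `Ind λ_s` is
reducible iff `γ_m(wλ,−s)γ_m(λ,s)` is zero at `s = 0`. We may assume `Re λ > 0`. Then the kernel of `A(w,λ)` is an irreducible invariant subspace of `Ind λ`,
which transforms as a special representation» + Theorem (2) (a)(b)(d).  [Casselman1995] §7.1 (`P` maximal, here `P = B`, `W = {1, w₀}`): Lemma 7.1.1 (a)
`0 → (w⁻¹σ)δ_P^{1/2} → I_N → σδ_P^{1/2} → 0`; Cor. 7.1.2 «the length of `I` is at most 2»; Prop. 7.1.3 «suppose `|σ(a)| < 1` for `a ∈ A⁻ ∖ A_∅(𝒪)A_Δ`. Then any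
proper subrepresentation `π ⊆ I` is square-integrable mod `Z_G`» (via Thm 4.4.6 ∕ 6.5.1).

THE CUT (5 stubs + kernel-checked composition `keysCaseTwo_of_stubs`; `I := cmPrincipalSeries L 3 v χ_ξ`, `χ_ξ := cmXiTorusChar L v μ η₁ η₂`):
* `stub_keysCaseTwoReducible : KeysCaseTwoReducible L` (S1 = tree node N4, LETTER [Keys1984 §7 Thm (2)] = ★ named fact p826369, typ-T3a; BY NAME since ED. v4)
  — `I` has a proper non-zero subrepresentation at every non-split `v` (its value at one datum `(h : KeysCaseTwoReducible L) v hns μ η₁ η₂ hμ hμc h1c h2c : ∃ N, N ≠ ⊥ ∧ N ≠ ⊤` is consumed inside the composition; a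
  stand-alone restatement costs ≈ 10⁶ heartbeats of instance-path unification and is omitted).
* `stub_labelledPair_of_reducible` (S2 = node N3 junction, PAYABLE-M over N1 `U3PrincipalSeriesJacquetModule` + N2 `U3PrincipalSeriesConstituentJacquetNonzero`
  + ★ `jacquet_exact_of_charZero_holds` + R1 `χ_ξ ≠ wχ_ξ`; [Casselman1995 L. 7.1.1 (a), Cor. 7.1.2, Prop. 6.4.1; BZ77 Thm 2.8, 2.12]) — if `I` is reducible then its
  constituents are EXACTLY two classes `πs ≠ πn`, `πs` with normalised Jacquet character `χ_ξ`, `πn` with `wχ_ξ = (χ̄_ξ,1⁻¹, χ_ξ,2)`.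
* `stub_isSquareIntegrable_iff_decays` (S3 = node N5 one-character instance, LETTER [Casselman1995 Thm 4.4.6, P_∅ = B, A_Δ = 1]; T3a
  `Rogawski1990.U3SquareIntegrableIffExponents`) — an admissible class whose normalised Jacquet module is the character `θ` is square-integrable modulo the
  (compact) centre iff `|θ(a)| < 1` on `A⁻ ∖ A(𝒪)`, `A = {d(a, 1, a⁻¹) : a ∈ F^×}`.
* `stub_decays_xi` (S4 = R3, **CLOSED in ED. v2** — proved here over ★ vocabulary, TRIO) — `χ_ξ` decays on `A⁻`: `|χ_ξ(d(a,1,a⁻¹))| = ‖a‖_E^{1/2} < 1`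
  for `‖a‖ < 1` (`η̃₁(a) = 1`; `|μ(a)| = 1` from `μ(a)² = μ(σ(a)a) = 1`; `det d(a,1,a⁻¹) = 1`).
* `stub_not_decays_wxi` (S5 = R4, **CLOSED in ED. v2**, TRIO) — `wχ_ξ` does not: at `a = Nm(v) ∈ ℕ ⊂ F^×` (a `σ`-fixed unit of `Π_{w∣v} L_w` lying in every
  `w ∣ v`, of module `< 1` by the Haar-measure argument `2·‖a‖·μ(Π𝒪_w) ≤ μ(Π𝒪_w)` — `a·Π𝒪_w` and `1 + a·Π𝒪_w` are disjoint translates inside `Π𝒪_w`),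
  `|wχ_ξ(d(a,1,a⁻¹))| = ‖a‖^{-1/2} > 1`.  ED. v3: the seven junction lemmas are ★ p826744 `Literature/NumberTheory/Automorphic/CMXiTorusCharSplitTorusDecay.lean`
  (`quotConj_eq_one_of_map_eq`, `torusDet_eq_one_of_torusEntry`, `norm_apply_eq_one_of_isQuadraticCharExtension`, `cmXiTorusChar_apply`,
  `unitModulusChar_lt_one_of_forall_v_lt_one`, `exists_map_eq_unitModulusChar_lt_one`, `exists_torusU_entry_eq`, + the two exponent theorems).  OPEN stubs after v2: S1 (LETTER Keys), S2 (PAYABLE-M junction), S3 (LETTER Casselman 4.4.6) — `sorry` count 3.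
Then `keysCaseTwo_holds : KeysCaseTwo L` (sorry only through the stubs) and the closed registered head `keysCaseTwo_closed : KeysCaseTwoClosed` (= the telescope
`∀ L, KeysCaseTwo L` of `stub_Keys`).  ED. v3: `wχ_ξ` IS ★ `cmWeylTorusCharPair L v (η̃₁·μ·‖·‖^{1/2}) η₂` (typ-T3a p825973; T3a «=» 15:00:51Z), S4∕S5 are 1∕3-line glue to ★ p826744
`CMXiTorusCharSplitTorusDecay`; two LOCAL Lines-level abbreviations remain: `DecaysOnSplitTorus` (T3a «=»: the inner clause of N5 `U3SquareIntegrableExponents`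
verbatim) and `HasJacquetChar` (T3a «≠ by design»: one-character iso form; N5's currency is ★ `Representation.HasJacquetExponent`; glue (g1) 1-dim linear
algebra + (g2) unitary central character at non-split `v` — both S-sized, part of the S3 pay-down).

ED. v8 (this edition) = ED. v7 af9ee73bf80b9882 with N5′ DERIVED: `stub_subrepSquareIntegrable := F0P3U3SubrepSquareIntegrableOfExponents.u3PrincipalSeriesSubrepSquareIntegrable_of_exponents L
(stub_casselmanCriterion L) (stub_jacquetFiltration L) (stub_constituentEmbeds L)` (★ J2 p830391, A-p01 (g18)); `sorry` count 5 = LETTERS {S1 = N4 [Keys1984 §7 Thm (2)], N5 [Casselman1995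
Thm 4.4.6]} · IN FLIGHT {S2 (p02 (g8)), N1 (B-p10 (g21) assembler), N2 (F0P3-p01 (g10))}; PROVED∕DERIVED here: G3 glue, N3 (J1), N5′ (J2), S3 junction, S4, S5, composition.
ED. v7 = ED. v6 67d92f18829f773b with N3 DERIVED: `stub_lengthLeTwo := F0P3U3LengthLeTwoOfEmbeds.u3PrincipalSeriesLengthLeTwo_of_embeds L (stub_jacquetFiltration L)
(stub_constituentEmbeds L)` (★ J1 p829972, A-p01 (g18)) over the NEW by-name stub `stub_constituentEmbeds : U3PrincipalSeriesConstituentEmbeds L` (N2 ★ p826667, PAYABLE-M; junction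
in flight F0P3-p01 (g10)); `sorry` count 6 = LETTERS {S1 = N4, N5} · IN FLIGHT {S2 (p02 (g8)), N1 (assembler B-p10 (g21) over ★ (L-a…d) p828444∕p829008∕p829151∕p829479∕p829651 +
★ p828686 + A-p19∕A-p13 pieces), N2 (F0P3-p01 (g10)), N5′ (J2, A-p01 (g18))} · PROVED here: G3 glue, N3 derivation, S3 junction, S4, S5, composition.
ED. v6 = ED. v5 33c1d2660390918a with `stub_centralCharUnitary` (G3) CLOSED BY NAME (★ p827424 `F0P3bCentralCharacterUnitaryNonsplit.exists_centralChar_norm_eq_one_of_nonsplit`,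
A-p01 (g17); one `@`-application across ★ `cmDatum_Local_eq`): `sorry` count 6 = LETTERS {S1 = N4, N5} · IN FLIGHT {S2 (p02 (g8))} · PAYABLE unminted {N1 (L), N3 (M; A-p01 (g18) bid J1
«N3 ⇐ N1 + N2» 15:52:21Z), N5′ (M; A-p01 (g18) bid J2 «N5′ ⇐ N5 + N1 + N2»)}; PROVED here: S3 junction, G3 glue, S4, S5, composition.
ED. v5 (statements of S1∕S2-conclusion∕S3∕S4∕S5 and of the composition `keysCaseTwo_of_stubs` BYTE-UNCHANGED from ED. v4 9d7443d81f71874f):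
* S3 IS NO LONGER A STUB TEXT: it is PROVED here (`isSquareIntegrable_iff_decays`, axioms TRIO) as the junction «N5 + G3 + G5 ⇒ S3» over the LETTER BY NAME
  `stub_casselmanCriterion : U3SquareIntegrableExponents L` (★ p826342, tree node N5 [Casselman1995 Thm. 4.4.6]), the glue stub `stub_centralCharUnitary` (G3 «admissible
  irreducible `π` of `U(Φ₃)(L⁺_v)`, `v` non-split, has a UNITARY central character» — PAYABLE-S, in flight: A-p01 (g17) bid 15:23:41Z
  `Literature/NumberTheory/Automorphic/LocalUnitaryGroupCentralCharacterUnitary.lean`; becomes a ≤ 3-line glue when ★) and ★ G5 p827046 (+ the companion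
  `hasJacquetExponent_of_equiv_twist_trivial` proved here: `r(π) ≅ θ ⇒ θ` IS an exponent).
* S2's stub now carries p02 (g8)'s head shape (bid 15:29:00Z, «=» 15:30:36Z): the four Literature facts N1, N3, N5, N5′ as HYPOTHESES BY NAME, fed by the by-name stubs
  `stub_jacquetFiltration` (N1 ★ p826240, PAYABLE-L), `stub_lengthLeTwo` (N3 ★ p826287, PAYABLE-M), `stub_casselmanCriterion` (N5, LETTER), `stub_subrepSquareIntegrable`
  (N5′ ★ p826314, LETTER today ∕ PAYABLE-M from N5) — so that `Theorems/F0P3KeysLabelledPair.labelledPair_of_reducible` (p02, in flight) closes S2 by ONE application.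
* `sorry` count 7, ALL by-name or minted: LETTERS {S1 = N4 [Keys1984 §7 Thm (2)], N5 [Casselman1995 Thm 4.4.6]} · PAYABLE in flight {S2 (p02 (g8)), G3 (A-p01 (g17))} ·
  PAYABLE unminted {N1 (L), N3 (M), N5′ (M given N5)}; PROVED here: S3 junction, S4, S5, composition.  BOOKS when registered: row NF1 `KeysCaseTwo` is READ as the
  by-name letters {N4, N5} + {N1, N3, N5′ until paid}; nothing is discharged until the payable stubs close.

DEF∕PROOF discipline: `sorry` ONLY inside the `stub_*` (5 in ED. v8; 6 in ED. v7∕v6; 7 in ED. v5, see above); no instance, no notation, no axiom; `--supports stmt-HodgeConjecture-24833` when registered.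
-/

set_option autoImplicit false
set_option linter.dupNamespace false

noncomputable section

open NumberField IsDedekindDomain MeasureTheory
open Literature.NumberTheory.Rogawski1990
open Literature.NumberTheory.Automorphic Literature.NumberTheory.Automorphic.UnitaryGroup
open scoped Matrix NNReal ENNReal Pointwise

namespace Summit.HodgeConjecture.HodgeConjecture.Cruxes.H413.F0P3KeysCaseTwoPaydown

open Summit.HodgeConjecture.HodgeConjecture.Cruxes.H413.F0P3XiPacketFamilyOfRecord (isAdmissible_of_isConstituentOf)

variable (L : Type) [Field L] [NumberField L] [IsCMField L]

/-! ## §0 Line-local abbreviations (work-file only; INLINED verbatim in the ★ Theorems twin `F0P3KeysCaseTwoOfStubs` p831694, which has 0 `def`) -/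

/-- LINE-LOCAL ABBREVIATION (cf. ★ `HasJacquetExponent`, p825973): «the class `c ∈ Irr(U(Φ₃)(L⁺_v))` has NORMALISED Jacquet module (w.r.t. the
upper-triangular Borel `B = TN`, ★ `cmBorelTriple`) isomorphic to the one-dimensional character `θ` of `T`» — i.e. `r_B(π) ⊗ δ_B^{-1/2} ≅ θ` for a (any)
representative `π` of `c` (Casselman's «central character of `π` with respect to `P_∅`», here a single exponent). [cite: Casselman1995, §4.4 p. 45, Prop. 6.4.1]
[cite: BernsteinZelevinsky1977, §2.3] -/
def HasJacquetChar (v : HeightOneSpectrum (𝓞 ↥(maximalRealSubfield L))) (c : IrrClass (Gqs L v))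
    (θ : ↥(torusU (conjLocal L (IsCMField.complexConj L) v) (cmLocalForm L 3 v)) →* ℂˣ) : Prop :=
  haveI := locallyCompactSpace_cmBorelU L 3 v
  ∃ r : SmoothIrrep (Gqs L v), IrrClass.mk r = c ∧
    Nonempty ((r.ρ.normalizedJacquet (cmBorelTriple L 3 v)).Equiv
      ((Representation.trivial ℂ ↥(torusU (conjLocal L (IsCMField.complexConj L) v) (cmLocalForm L 3 v)) ℂ).twist θ))

/-- LINE-LOCAL ABBREVIATION (= the inner decay clause of ★ N5 `U3SquareIntegrableExponents`, verbatim): «the character `θ` of `T` DECAYS on the negative chamber of the maximal `F`-split torus»: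
`|θ(d(a, 1, a⁻¹))| < 1` for every `a ∈ F^× = (L⁺_v)^×` (the `σ`-fixed units of `L_v = ∏_{w∣v} L_w`) with `‖a‖ < 1` — Casselman's condition (b)
«`|χδ_∅^{-1/2}(a)| < 1` for all `a ∈ A_∅⁻ ∖ A_∅(𝒪)A_Δ`» for `G = U(Φ₃)(F)` (`A_Δ = 1`, `A_∅ = {d(a,1,a⁻¹)}`, `A⁻∖A(𝒪) = {‖a‖ < 1}`), read on the normalised
exponent `θ = χδ_∅^{-1/2}`; `d(a,1,a⁻¹)` is encoded as «`t ∈ T` with `σ`-fixed first entry and middle entry `1`» (then `t₂₂ = ā⁻¹ = a⁻¹`).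
[cite: Casselman1995, Thm 4.4.6 (b)] -/
def DecaysOnSplitTorus (v : HeightOneSpectrum (𝓞 ↥(maximalRealSubfield L)))
    (θ : ↥(torusU (conjLocal L (IsCMField.complexConj L) v) (cmLocalForm L 3 v)) →* ℂˣ) : Prop :=
  ∀ t : ↥(torusU (conjLocal L (IsCMField.complexConj L) v) (cmLocalForm L 3 v)),
    conjLocal L (IsCMField.complexConj L) v
        ((torusEntry (conjLocal L (IsCMField.complexConj L) v) (cmLocalForm L 3 v) 0 t : (LocalRing L v)ˣ) : LocalRing L v) =
      ((torusEntry (conjLocal L (IsCMField.complexConj L) v) (cmLocalForm L 3 v) 0 t : (LocalRing L v)ˣ) : LocalRing L v) →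
    torusEntry (conjLocal L (IsCMField.complexConj L) v) (cmLocalForm L 3 v) 1 t = 1 →
    unitModulusChar (LocalRing L v) (torusEntry (conjLocal L (IsCMField.complexConj L) v) (cmLocalForm L 3 v) 0 t) < 1 →
    ‖((θ t : ℂˣ) : ℂ)‖ < 1

variable (v : HeightOneSpectrum (𝓞 ↥(maximalRealSubfield L)))

/-! ## §1 The stubs (registered ED. 7: NO `sorry` — the print letter #96 [GelbartRogawski1991 §3.2 (3.2.1)–(3.2.2); Kudla1986 Thm 2.8] `stub_thetaTypeJacquetModule` CLOSED IN-HOUSE by ★ p839151 (F0P2-p06 (g4), road (N′) `…_of_lineJacquet lineJacquet_holds`); N4 [Keys1984 §7 Thm (2)] CLOSED-DERIVED from #96 by ★ p835809 (B-p14 (g28) FILE 3: B-p10 (1b) `exists_subrepresentation_ne_bot_ne_top_of_N3` + GLOB ★ p834791 + reparametrisation); N5 [Casselman1995 Thm 4.4.6] CLOSED IN-HOUSE by ★ p834912 (F0P3-p01 (g10), road R1–R6: Casselman's criterion for `U(3)` proved in the tree); S2 CLOSED by ★ p833040; N1 CLOSED IN-HOUSE by ★ p832625; N2, N3, N5′ hypothesis-free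 via ★ p833019 — and the PROVED G3 glue, S3 junction, S4, S5) -/

/-- **STUB #96 — LETTER [GelbartRogawski1991 §3.2 (3.2.1)–(3.2.2) p. 457; Kudla1986 Thm. 2.8] = ★ NAMED FACT `GelbartRogawski1991.thetaType_nonsplit_jacquetModule` (typ p826177; books #96), consumed BY NAME (ED. 6): the Jacquet module of the θ-type
local representation `X_v(μ, ε, χ_f)` at a NON-SPLIT place** — (a) `r_N(X_v) ≃ ℱ_v[ψθ]` (the `ψθ`-weight space of GR's rank-one oscillator representation), (b) the diagonal torus acts on
`r_N(X_v)` by `χθ = cmXiTorusChar L v μ_v ψθ⁻¹ ψθ`.  The SAME letter as the F0∕P2 lines' `stub_N3_letter` ∕ K1 `StubThetaInPS` (`Cruxes/H413/Lines/F0_P2GR91NJacquet.lean`): ONE print input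
shared by T3b and P2; **CLOSED IN-HOUSE (registered ED. 7)** by ★ p839151 `F0P2oLineJacquetHolds.thetaType_nonsplit_jacquetModule_holds` (F0P2-p06 (g4), road (N′) `…_of_lineJacquet lineJacquet_holds`) — #96 leaves the `sorry` census and the line is sorry-free.  N4 [Keys1984 §7 Thm (2)] is CLOSED-DERIVED from it (B-p10 (1b) `exists_subrepresentation_ne_bot_ne_top_of_N3`: at θ-data `i_G(χ_ξ)` contains the
θ-type constituent `πⁿ`, proper and non-zero; GLOB ★ p834791 `ConjugateSymplecticLocalComponentSurjective`: every local datum `(μ, η₁, η₂)` of `KeysCaseTwoReducible` is a θ-datum after reparametrisation).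
[cite: GelbartRogawski1991, §3.2 (3.2.1)–(3.2.3) p. 457] [cite: Kudla1986, Thm. 2.8] [cite: GelbartRogawski1990, Prop. 5.2.2] -/
theorem stub_thetaTypeJacquetModule : Literature.NumberTheory.GelbartRogawski1991.thetaType_nonsplit_jacquetModule :=
  -- ED. 7: CLOSED IN-HOUSE — ★ p839151 (F0P2-p06 (g4), road (N′) `…_of_lineJacquet lineJacquet_holds`).
  F0P2oLineJacquetHolds.thetaType_nonsplit_jacquetModule_holds

/-- **STUB S1 — LETTER [Keys1984 §7 Thm (2)] = ★ NAMED FACT `Rogawski1990.KeysCaseTwoReducible L` (tree node N4, typ-T3a p826369), consumed BY NAME (ED. v4): `i_G(χ_ξ)` IS REDUCIBLE at every non-split `v`** — it has a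
`G`-stable subspace other than `0` and itself.  Keys: reducible non-unitary principal series of `SU(3)`, `Re s > 0`: (E∕F unramified) (a) `|·|_E^s` at `s = 1`,
`s = ½ + πi(2 ln q)⁻¹`, (b) `λ` ramified with `λ|F^× = 1` at `s = ½ + πi(2 ln q)⁻¹`; (E∕F ramified) (c) `s = 1`, (d) `λ|𝒪_F^×` of order 2 at `s = ½` — i.e.
`χ₁ = η‖·‖_E^{1/2}`, `η|F^× = ω_{E/F}` (Rogawski's case (2)); `U(3) = T·SU(3)` and `i_{U(3)}(χ)|_{SU(3)} = i_{SU(3)}(χ|)`.  **CLOSED-DERIVED (registered ED. 6)** from the #96 letter by ★ p835809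
`F0P3KeysCaseTwoReducibleOfN3.keysCaseTwoReducible_of_N3` (B-p14 (g28) FILE 3) — N4 leaves the `sorry` census; books #106 CLOSED-derived from #96 (director s706).
[cite: Keys1984, §7 Theorem (2) p. 126] [cite: Rogawski1990, §12.2 (2) pp. 173–174] [cite: Casselman1995, Thm 6.6.2] -/
theorem stub_keysCaseTwoReducible : KeysCaseTwoReducible L :=
  -- ED. 6: CLOSED-DERIVED from the #96 letter — ★ p835809 (B-p14 (g28) FILE 3 over B-p10 (1b) θ-type reducibility + GLOB ★ p834791 + the `cmXiTorusChar` reparametrisation).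
  F0P3KeysCaseTwoReducibleOfN3.keysCaseTwoReducible_of_N3 L stub_thetaTypeJacquetModule

/-- **STUB N1 — BY NAME, PAYABLE-L [Casselman1995 Lemma 7.1.1 (a); BZ77 2.12, Cor. 2.13 (c)]** (★ p826240 `UnitaryGroup.U3PrincipalSeriesJacquetFiltration`, typ-T3a):
`r_B i_G(χ)` is two-dimensional with line `wχ` and quotient `χ` (hypothesis `hN1` of p02's S2 head).  **CLOSED IN-HOUSE (registered ED. 3)** by ★ p832625
`F0P3U3PrincipalSeriesJacquetFiltrationHolds.U3PrincipalSeriesJacquetFiltration_holds` (B-p10 (g21) assembler: closed-cell∕open-cell filtration ★ `CMPrincipalSeriesOpenCellSection`, Weyl action on the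
open-cell line = ★ γ-W p831847 `F0P3U3PrincipalSeriesOpenCellTorusChar.torus_normalizedJacquet_openCellLine_eq_weylChar` (A-p13 (g27)), bridges ★ p831282) — N1 leaves the `sorry` census;
books #107 PROVED IN THE TREE. [cite: Casselman1995, Lemma 7.1.1 (a) p. 67] [cite: BernsteinZelevinsky1977, 2.12, Cor. 2.13 (c)] -/
theorem stub_jacquetFiltration : U3PrincipalSeriesJacquetFiltration L :=
  F0P3U3PrincipalSeriesJacquetFiltrationHolds.U3PrincipalSeriesJacquetFiltration_holds L

/-- **STUB N2 — BY NAME, PAYABLE-M [Casselman1995 Cor. 6.3.9 (b); BZ77 2.4–2.9]** (★ p826667 `UnitaryGroup.U3PrincipalSeriesConstituentEmbeds`, typ-T3a): every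
irreducible constituent of `i_G(χ)` embeds in `i_G(χ)` or in `i_G(wχ)` (it has a non-zero Jacquet module).  Hypothesis `hN2` of ★ J1 (N3 ⇐ N1 + N2, p829972) and of J2
(N5′ ⇐ N5 + N1 + N2, A-p01 (g18), ★ p830391); road: ★ brick A p829038 `exists_character_quotient_injective_intertwiningMap_cmPrincipalSeries` (F0P3-p01 (g10)) + «no
cuspidal constituent» + N1's two exponents. **CLOSED-derived (registered ED. 2)** by ★ p831765 `F0P3U3ConstituentEmbedsOfJacquet.u3PrincipalSeriesConstituentEmbeds_of_jacquetFiltration`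
(F0P3-p01 (g10); «every constituent has `r_B ≠ 0`» = ★ N6 `Rogawski1990.u3_isSupercuspidal_iff_jacquet_eq_zero_holds` inside) from N1 = `stub_jacquetFiltration` — N2 leaves the
`sorry` census; books #108 DERIVED from #107. [cite: Casselman1995, Cor. 6.3.9 (b) p. 60] [cite: BernsteinZelevinsky1977, §2.4–2.9] -/
theorem stub_constituentEmbeds : U3PrincipalSeriesConstituentEmbeds L :=
  -- ED. 4: the hypothesis-free ★ name (★ p833019, A-p01 (g18)) = ★ p831765 applied to ★ p832625.
  F0P3U3PrincipalSeriesLettersHold.u3PrincipalSeriesConstituentEmbeds_holds L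

/-- **STUB N3 — DERIVED IN ED. v7 (★ J1 p829972 «N3 ⇐ N1 + N2», A-p01 (g18)); was BY NAME, PAYABLE-M [Casselman1995 Cor. 7.1.2; BZ77 Thm 2.8]** (★ p826287 `UnitaryGroup.U3PrincipalSeriesLengthLeTwo`, typ-T3a): no chain
`0 ⊊ N₁ ⊊ N₂ ⊊ i_G(χ)` (hypothesis `hN3` of p02's S2 head). [cite: Casselman1995, Cor. 7.1.2 p. 67] [cite: BernsteinZelevinsky1977, Thm. 2.8] -/
theorem stub_lengthLeTwo : U3PrincipalSeriesLengthLeTwo L :=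
  -- ED. v7: DERIVED — ★ J1 p829972 (A-p01 (g18)) from N1 + N2; ED. 4: the hypothesis-free ★ name (★ p833019).
  F0P3U3PrincipalSeriesLettersHold.u3PrincipalSeriesLengthLeTwo_holds L

/-- **STUB N5 — LETTER BY NAME [Casselman1995 Thm. 4.4.6, `F`-rank one]** (★ p826342 `UnitaryGroup.U3SquareIntegrableExponents`, typ-T3a): an admissible
`ω`-representation `π` of `U(Φ₃)(L⁺_v)` (`v` non-split) is square-integrable modulo the centre (`|ω| = 1` AND ★ `IsSquareIntegrableModCenter μZ`) iff `|ω| = 1` and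
every exponent `χ′` (★ `HasJacquetExponent (cmBorelTriple L 3 v) χ′`) satisfies `‖χ′(d(t,1,t⁻¹))‖ < 1` for `‖t‖ < 1`.  The S3 junction below instantiates it at an
irreducible class with `r(π) ≅ θ`; it is also hypothesis `hN5` of p02's S2 head. [cite: Casselman1995, Thm. 4.4.6 p. 45; §1.4 p. 13; §2.5 p. 28] -/
theorem stub_casselmanCriterion : U3SquareIntegrableExponents L :=
  -- ED. 5: CLOSED IN-HOUSE — ★ p834912 (F0P3-p01 (g10)), Casselman's criterion [Casselman1995 Thm 4.4.6] for `U(3)` at a non-split CM place, proved over R1–R6.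
  F0P3U3SquareIntegrableExponentsHolds.u3SquareIntegrableExponents_holds L

/-- **STUB N5′ — DERIVED IN ED. v8 (★ J2 p830391 «N5′ ⇐ N5 + N1 + N2», A-p01 (g18)); was BY NAME [Casselman1995 Prop. 7.1.3]** (★ p826314 `UnitaryGroup.U3PrincipalSeriesSubrepSquareIntegrable`, typ-T3a):
proper subrepresentations of `i_G(χ)` with `|χ₁| < 1` on `A⁻ ∖ A(𝒪)` are square-integrable modulo the centre (hypothesis `hN5'` of p02's S2 head).
[cite: Casselman1995, Prop. 7.1.3 p. 67] -/
theorem stub_subrepSquareIntegrable : U3PrincipalSeriesSubrepSquareIntegrable L :=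
  -- ED. v8: DERIVED — ★ J2 p830391 (A-p01 (g18)) from N5 (letter) + N1 + N2; ED. 4: ★ p833019's `…_of_N5` (N1, N2 inside), N5 = the letter stub.
  F0P3U3PrincipalSeriesLettersHold.u3PrincipalSeriesSubrepSquareIntegrable_of_N5 L (stub_casselmanCriterion L)


set_option synthInstance.maxHeartbeats 400000 in
set_option maxHeartbeats 4000000 in  -- ED. 4 junction: instance-path unification between ★ p833040's elaboration of the CM carrier ∕ Jacquet clause and this file's (`HasJacquetChar` unfolds by `rfl`; ≈ 10⁶ beats, cf. S3 below and p833040's own header)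
/-- **STUB S2 — PAYABLE-M junction (tree node N3 over N1 + N2 + ★ exactness + R1; T3a `Rogawski1990.U3PrincipalSeriesLengthLeTwo` ∕ `…JacquetModule` ∕
`…ConstituentJacquetNonzero`): if `i_G(χ_ξ)` is reducible, its constituents are EXACTLY two classes `πs ≠ πn`, labelled by their normalised Jacquet
characters `χ_ξ` (for `πs`) and `wχ_ξ` (for `πn`).**  Print: Casselman L. 7.1.1 (a) `0 → (w⁻¹σ)δ^{1/2} → I_N → σδ^{1/2} → 0`, Cor. 7.1.2 «length of `I` at most
2» (each factor has `U_N ≠ 0` by 6.3.7 and `I_N` has length 2 by exactness 3.2.3), Prop. 6.4.1 (σ regular ⇒ `I_N ≅ ⊕ (w⁻¹σ)δ^{1/2}`); Rogawski «exactly two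
irreducible constituents ([BZ])»; BZ77 Thm 2.8 `l(i_{G,M}ρ) ≤ l(M) = 2`.  RE-POINTING (ED. v5): the four facts N1, N3, N5, N5′ are HYPOTHESES BY NAME.  **CLOSED (registered ED. 4)** by ★ p833040 `F0P3KeysLabelledPair.labelledPair_of_reducible` (F0P3-p02 (g8)) — this stub := that head, one application; S2 leaves the `sorry` census.
[cite: Casselman1995, Lemma 7.1.1 (a), Cor. 7.1.2, Prop. 6.4.1] [cite: BernsteinZelevinsky1977, Thm 2.8, 2.12] [cite: Rogawski1990, §12.2 p. 173] -/
theorem stub_labelledPair_of_reducible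
    (hN1 : U3PrincipalSeriesJacquetFiltration L) (hN3 : U3PrincipalSeriesLengthLeTwo L)
    (hN5 : U3SquareIntegrableExponents L) (hN5' : U3PrincipalSeriesSubrepSquareIntegrable L)
    (hns : ∀ w : PlacesOver L v, IsCMField.complexConj L • w.1 = w.1)
    (μ : (LocalRing L v)ˣ →* ℂˣ) (η₁ η₂ : ↥(normOneUnits (conjLocal L (IsCMField.complexConj L) v)) →* ℂˣ)
    (hμ : IsQuadraticCharExtension (conjLocal L (IsCMField.complexConj L) v) μ)
    (hμc : Continuous fun x => ((μ x : ℂˣ) : ℂ)) (h1c : Continuous fun x => ((η₁ x : ℂˣ) : ℂ)) (h2c : Continuous fun x => ((η₂ x : ℂˣ) : ℂ))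
    (hred : ∃ N : Subrepresentation (cmPrincipalSeries L 3 v (cmXiTorusChar L v μ η₁ η₂)), N ≠ ⊥ ∧ N ≠ ⊤) :
    ∃ πs πn : IrrClass (Gqs L v), πs ≠ πn ∧
      (∀ c : IrrClass (Gqs L v), c.IsConstituentOf (cmPrincipalSeries L 3 v (cmXiTorusChar L v μ η₁ η₂)) ↔ (c = πn ∨ c = πs)) ∧
      HasJacquetChar L v πs (cmXiTorusChar L v μ η₁ η₂) ∧ HasJacquetChar L v πn (cmWeylTorusCharPair L v
        (η₁.comp (quotConj (conjLocal L (IsCMField.complexConj L) v) (conjLocal_conjLocal_cm L v)) * μ * halfModulusChar (LocalRing L v)) η₂) :=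
  -- ED. 4: CLOSED BY NAME — ★ F0P3-p02 (g8) `F0P3KeysLabelledPair.labelledPair_of_reducible` (Casselman §7.1 over ★ N1∕N2∕N3 by name; the two
  -- `HasJacquetChar` clauses are its inlined conclusions, definitionally); `hN5`, `hN5'` are now unused by the junction (kept: statement byte-unchanged).
  (fun (_ : U3SquareIntegrableExponents L) (_ : U3PrincipalSeriesSubrepSquareIntegrable L) =>
      F0P3KeysLabelledPair.labelledPair_of_reducible L v hN1 (stub_constituentEmbeds L) hN3 hns μ η₁ η₂ hμ hμc h1c h2c hred) hN5 hN5'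

/-- **STUB G3 — CLOSED IN ED. v6 BY NAME (★ p827424 `F0P3bCentralCharacterUnitaryNonsplit.exists_centralChar_norm_eq_one_of_nonsplit`, generic half ★ p827334 `CentralCharacterCompactCenter`, A-p01 (g17); was PAYABLE-S in ED. v5):
at a NON-SPLIT `v`, an admissible irreducible representation `π` of `G = U(Φ₃)(L⁺_v)` has a central character `ω : Z(G) →* ℂˣ` (`π(z) x = ω(z) x`: Schur, ★
`Representation.exists_hasCentralCharacter_holds` ∕ `IsSmooth.exists_apply_eq_smul_id_of_mem_center` — `G` is second countable, ★ `secondCountableTopology_cmDatum_local`)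
which is UNITARY, `‖ω(z)‖ = 1` (the centre `U(1)(L⁺_v) = L_w¹` is COMPACT at non-split `v`, ★ p825600 `F0P3bLocalNonsplitCompactCenter` + ★ `forall_mem_center_cmLocal_eq_scalar`;
`ker ω ⊇ Z ∩ Stab(x)` is open, so `ω` is continuous and `ω(Z)` compact in `ℂˣ`).**  = the `(∀ z, ‖ω z‖ = 1)` clause of N5, token for token.
[cite: Casselman1995, Thm. 4.4.6 (a), §2.5 p. 28] [cite: BernsteinZelevinsky1976, Prop. 2.11] [cite: Rogawski1990, §12.2 p. 173] -/
theorem stub_centralCharUnitary (hns : ∀ w : PlacesOver L v, IsCMField.complexConj L • w.1 = w.1)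
    (V : Type) [AddCommGroup V] [Module ℂ V] (π : Representation ℂ (Gqs L v) V) [hirr : π.IsIrreducible] (hπ : π.IsAdmissible) :
    ∃ ω : ↥(Subgroup.center (Gqs L v)) →* ℂˣ,
      (∀ (z : ↥(Subgroup.center (Gqs L v))) (x : V), π (z : Gqs L v) x = ((ω z : ℂˣ) : ℂ) • x) ∧
      ∀ z : ↥(Subgroup.center (Gqs L v)), ‖((ω z : ℂˣ) : ℂ)‖ = 1 :=
  -- ED. v6: CLOSED BY NAME — ★ p827424 (A-p01 (g17)) at `N = 3`, across the `rfl` carrier identification ★ `cmDatum_Local_eq` (instances passed explicitly).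
  @F0P3bCentralCharacterUnitaryNonsplit.exists_centralChar_norm_eq_one_of_nonsplit L _ _ _ 3 v hns V _ _ π hirr hπ

/-- **`r(π) ≅ θ` ⇒ `θ` IS an exponent** (generic, any parabolic triple; companion of ★ G5 `HasJacquetExponent.eq_of_equiv_twist_trivial`, A-p01 p827046): the vector
`e⁻¹(1)` is a non-zero `θ`-eigenvector of `M` in the normalised Jacquet module. [cite: Casselman1995, §4.4 p. 45] [folklore] -/
theorem hasJacquetExponent_of_equiv_twist_trivial {G : Type*} [Group G] [TopologicalSpace G] [IsTopologicalGroup G]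
    (t : ParabolicTriple G) [LocallyCompactSpace t.P] {V : Type*} [AddCommGroup V] [Module ℂ V]
    {ρ : Representation ℂ G V} {θ : ↥t.M →* ℂˣ}
    (e : (ρ.normalizedJacquet t).Equiv ((Representation.trivial ℂ ↥t.M ℂ).twist θ)) :
    ρ.HasJacquetExponent t θ := by
  refine ⟨e.toLinearEquiv.symm 1, e.toLinearEquiv.symm.map_ne_zero_iff.2 one_ne_zero, fun m => ?_⟩
  apply e.toLinearEquiv.injective
  have h1 : e.toLinearEquiv (ρ.normalizedJacquet t m (e.toLinearEquiv.symm 1)) =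
      ((Representation.trivial ℂ ↥t.M ℂ).twist θ) m (e.toLinearEquiv (e.toLinearEquiv.symm 1)) :=
    Representation.IntertwiningMap.isIntertwining _ _ e.toIntertwiningMap m _
  rw [h1, map_smul, LinearEquiv.apply_symm_apply, Representation.twist_apply, Representation.trivial_apply]

set_option maxHeartbeats 4000000 in  -- the facts' literal carrier `↥(unitaryGroupOfForm (conjLocal …) (cmLocalForm L 3 v))` vs `Gqs L v` (defeq ★ `cmDatum_Local_eq`; instance-path unification)
/-- **S3 — PROVED JUNCTION (ED. v5; was the LETTER-instance stub of ED. v1–v4) «N5 [Casselman1995 Thm 4.4.6] + G3 + G5 ⇒ S3»: an ADMISSIBLE irreducible class `c` of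
`U(Φ₃)(L⁺_v)` (`v` non-split) whose normalised Jacquet module is the character `θ` (`HasJacquetChar`) is square-integrable modulo the centre (★ `IrrClass.IsSquareIntegrable μZ`)
iff `θ` decays on `A⁻ ∖ A(𝒪)` (`DecaysOnSplitTorus`).**  Proof: pick a representative `r` with `e : r(r.ρ) ≅ θ`; `r.ρ` is admissible (★ `IrrClass.isAdmissible_mk`) with a
unitary central character `ω` (G3); by G5 (★ `eq_of_equiv_twist_trivial`) every exponent of `r.ρ` is `θ`, and `θ` is one (`hasJacquetExponent_of_equiv_twist_trivial`); N5 at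
`(v, μZ, r.V, r.ρ, ω)` then reads «`r.ρ` square-integrable mod centre ⇔ `θ` decays», and ★ `IrrClass.isSquareIntegrable_mk_iff` moves the label to the class.  Axioms TRIO
(N5 and G3 enter as the explicit hypotheses `hN5`, `hG3`). [cite: Casselman1995, Thm 4.4.6, Prop. 7.1.3] [cite: Rogawski1990, §12.2 (2) pp. 173–174] -/
theorem isSquareIntegrable_iff_decays (hN5 : U3SquareIntegrableExponents L)
    (hns : ∀ w : PlacesOver L v, IsCMField.complexConj L • w.1 = w.1)
    (hG3 : ∀ (V : Type) [AddCommGroup V] [Module ℂ V] (π : Representation ℂ (Gqs L v) V) [π.IsIrreducible], π.IsAdmissible →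
      ∃ ω : ↥(Subgroup.center (Gqs L v)) →* ℂˣ,
        (∀ (z : ↥(Subgroup.center (Gqs L v))) (x : V), π (z : Gqs L v) x = ((ω z : ℂˣ) : ℂ) • x) ∧
        ∀ z : ↥(Subgroup.center (Gqs L v)), ‖((ω z : ℂˣ) : ℂ)‖ = 1)
    [i1 : MeasurableSpace (Gqs L v ⧸ Subgroup.center (Gqs L v))] [i2 : BorelSpace (Gqs L v ⧸ Subgroup.center (Gqs L v))]
    (μZ : Measure (Gqs L v ⧸ Subgroup.center (Gqs L v))) [i3 : μZ.IsHaarMeasure]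
    (c : IrrClass (Gqs L v)) (θ : ↥(torusU (conjLocal L (IsCMField.complexConj L) v) (cmLocalForm L 3 v)) →* ℂˣ)
    (hc : c.IsAdmissible) (hθ : HasJacquetChar L v c θ) :
    c.IsSquareIntegrable μZ ↔ DecaysOnSplitTorus L v θ := by
  obtain ⟨r, rfl, ⟨e⟩⟩ := hθ
  have hadm : r.ρ.IsAdmissible := (IrrClass.isAdmissible_mk r).1 hc
  obtain ⟨ω, hω, hω1⟩ := hG3 r.V r.ρ hadm
  haveI := locallyCompactSpace_cmBorelU L 3 v
  have hθexp := hasJacquetExponent_of_equiv_twist_trivial (cmBorelTriple L 3 v) e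
  have key := @hN5 v hns i1 i2 μZ i3 r.V _ _ r.ρ hadm ω hω
  rw [IrrClass.isSquareIntegrable_mk_iff μZ r]
  constructor
  · intro hsq t hfix h1 hm
    exact (key.1 ⟨hω1, hsq⟩).2 θ hθexp t hfix h1 hm
  · intro hdec
    refine (key.2 ⟨hω1, fun χ' hχ' => ?_⟩).2
    rw [hχ'.eq_of_equiv_twist_trivial (cmBorelTriple L 3 v) e]
    exact hdec

/-- **STUB S4 — CLOSED IN THIS DRAFT (was PAYABLE-S; junction R3, ★ vocabulary only): the exponent `χ_ξ = (η̃₁ μ ‖·‖^{1/2}, η₂)` DECAYS** — for `a ∈ F^×`, `‖a‖ < 1`: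
`|χ_ξ(d(a,1,a⁻¹))| = |η₁(a/ā)| · |μ(a)| · ‖a‖^{1/2} · |η₂(1)| = ‖a‖_E^{1/2} < 1` (`a/ā = 1`; `μ(a)² = μ(a²) = μ(ā a) = 1` by ★ `IsQuadraticCharExtension`, so
`|μ(a)| = 1`; ★ `xiTorusChar_apply`, ★ `halfModulusChar_sq`).  Casselman Prop. 7.1.3's hypothesis «`|σ(a)| < 1` for `a ∈ A⁻ ∖ A_∅(𝒪)A_Δ`».
[cite: Casselman1995, Prop. 7.1.3] [cite: Rogawski1990, §12.2 (2) p. 174] -/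
theorem stub_decays_xi (_hns : ∀ w : PlacesOver L v, IsCMField.complexConj L • w.1 = w.1)
    (μ : (LocalRing L v)ˣ →* ℂˣ) (η₁ η₂ : ↥(normOneUnits (conjLocal L (IsCMField.complexConj L) v)) →* ℂˣ)
    (hμ : IsQuadraticCharExtension (conjLocal L (IsCMField.complexConj L) v) μ)
    (_hμc : Continuous fun x => ((μ x : ℂˣ) : ℂ)) (_h1c : Continuous fun x => ((η₁ x : ℂˣ) : ℂ)) (_h2c : Continuous fun x => ((η₂ x : ℂˣ) : ℂ)) :
    DecaysOnSplitTorus L v (cmXiTorusChar L v μ η₁ η₂) :=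
  fun t hfix h1 hm => norm_cmXiTorusChar_lt_one L v μ η₁ η₂ hμ t hfix h1 hm

/-- **STUB S5 — CLOSED IN THIS DRAFT (was PAYABLE-S; junction R4, ★ vocabulary only): the exponent `wχ_ξ = (χ̄_ξ,1⁻¹, η₂)` does NOT decay** — `|wχ_ξ(d(a,1,a⁻¹))| = ‖a‖_E^{-1/2} > 1`
for one (any) `a ∈ F^×` with `‖a‖ < 1` (such `a` exists: `L⁺_v` is a non-discrete local field).  This is Rogawski's «`πⁿ(ξ)` is non-tempered» read through
Casselman 4.4.6 (b). [cite: Casselman1995, Thm 4.4.6 (b)] [cite: Rogawski1990, §12.2 (2) p. 174] -/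
theorem stub_not_decays_wxi (_hns : ∀ w : PlacesOver L v, IsCMField.complexConj L • w.1 = w.1)
    (μ : (LocalRing L v)ˣ →* ℂˣ) (η₁ η₂ : ↥(normOneUnits (conjLocal L (IsCMField.complexConj L) v)) →* ℂˣ)
    (hμ : IsQuadraticCharExtension (conjLocal L (IsCMField.complexConj L) v) μ)
    (_hμc : Continuous fun x => ((μ x : ℂˣ) : ℂ)) (_h1c : Continuous fun x => ((η₁ x : ℂˣ) : ℂ)) (_h2c : Continuous fun x => ((η₂ x : ℂˣ) : ℂ)) :
    ¬ DecaysOnSplitTorus L v (cmWeylTorusCharPair L v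
        (η₁.comp (quotConj (conjLocal L (IsCMField.complexConj L) v) (conjLocal_conjLocal_cm L v)) * μ * halfModulusChar (LocalRing L v)) η₂) := by
  intro hdec
  obtain ⟨t, hfix, h1, hm, hlt⟩ := exists_torusU_one_lt_norm_conj_inv L v μ η₁ η₂ hμ
  exact absurd (hdec t hfix h1 hm) (not_lt.2 hlt.le)

/-! ## §2 The kernel-checked composition: the five stub TEXTS imply `KeysCaseTwo L` BY NAME -/

set_option maxHeartbeats 3000000 in  -- instance-path unification `IrrClass (Gqs L v)` ↔ the literal carrier of `KeysCaseTwo` (≈ 10⁶ beats, < 30 s wall)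
/-- **`KeysCaseTwo L` FROM THE STUBS** (composition, no `sorry`): S1 ⇒ reducible; S2 ⇒ the labelled pair `(πs, πn)` with the exact constituent list; both
classes are admissible (★ `isAdmissible_cmPrincipalSeries`, ★ `isAdmissible_of_isConstituentOf`); S3 at `πs` with S4 ⇒ `πs` square-integrable; S3 at `πn` with
S5 ⇒ `πn` not. [cite: Rogawski1990, §12.2 (2) pp. 173–174] [cite: Casselman1995, §7.1] -/
theorem keysCaseTwo_of_stubs
    (h1 : KeysCaseTwoReducible L)
    (h2 : ∀ (v : HeightOneSpectrum (𝓞 ↥(maximalRealSubfield L))),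
      (∀ w : PlacesOver L v, IsCMField.complexConj L • w.1 = w.1) →
      ∀ (μ : (LocalRing L v)ˣ →* ℂˣ) (η₁ η₂ : ↥(normOneUnits (conjLocal L (IsCMField.complexConj L) v)) →* ℂˣ),
        IsQuadraticCharExtension (conjLocal L (IsCMField.complexConj L) v) μ →
        Continuous (fun x => ((μ x : ℂˣ) : ℂ)) → Continuous (fun x => ((η₁ x : ℂˣ) : ℂ)) → Continuous (fun x => ((η₂ x : ℂˣ) : ℂ)) →
        (∃ N : Subrepresentation (cmPrincipalSeries L 3 v (cmXiTorusChar L v μ η₁ η₂)), N ≠ ⊥ ∧ N ≠ ⊤) →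
        ∃ πs πn : IrrClass (Gqs L v), πs ≠ πn ∧
          (∀ c : IrrClass (Gqs L v), c.IsConstituentOf (cmPrincipalSeries L 3 v (cmXiTorusChar L v μ η₁ η₂)) ↔ (c = πn ∨ c = πs)) ∧
          HasJacquetChar L v πs (cmXiTorusChar L v μ η₁ η₂) ∧ HasJacquetChar L v πn (cmWeylTorusCharPair L v
        (η₁.comp (quotConj (conjLocal L (IsCMField.complexConj L) v) (conjLocal_conjLocal_cm L v)) * μ * halfModulusChar (LocalRing L v)) η₂))
    (h3 : ∀ (v : HeightOneSpectrum (𝓞 ↥(maximalRealSubfield L))),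
      (∀ w : PlacesOver L v, IsCMField.complexConj L • w.1 = w.1) →
      ∀ [MeasurableSpace (Gqs L v ⧸ Subgroup.center (Gqs L v))] [BorelSpace (Gqs L v ⧸ Subgroup.center (Gqs L v))]
        (μZ : Measure (Gqs L v ⧸ Subgroup.center (Gqs L v))) [μZ.IsHaarMeasure]
        (c : IrrClass (Gqs L v)) (θ : ↥(torusU (conjLocal L (IsCMField.complexConj L) v) (cmLocalForm L 3 v)) →* ℂˣ),
        c.IsAdmissible → HasJacquetChar L v c θ → (c.IsSquareIntegrable μZ ↔ DecaysOnSplitTorus L v θ))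
    (h4 : ∀ (v : HeightOneSpectrum (𝓞 ↥(maximalRealSubfield L))),
      (∀ w : PlacesOver L v, IsCMField.complexConj L • w.1 = w.1) →
      ∀ (μ : (LocalRing L v)ˣ →* ℂˣ) (η₁ η₂ : ↥(normOneUnits (conjLocal L (IsCMField.complexConj L) v)) →* ℂˣ),
        IsQuadraticCharExtension (conjLocal L (IsCMField.complexConj L) v) μ →
        Continuous (fun x => ((μ x : ℂˣ) : ℂ)) → Continuous (fun x => ((η₁ x : ℂˣ) : ℂ)) → Continuous (fun x => ((η₂ x : ℂˣ) : ℂ)) →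
        DecaysOnSplitTorus L v (cmXiTorusChar L v μ η₁ η₂))
    (h5 : ∀ (v : HeightOneSpectrum (𝓞 ↥(maximalRealSubfield L))),
      (∀ w : PlacesOver L v, IsCMField.complexConj L • w.1 = w.1) →
      ∀ (μ : (LocalRing L v)ˣ →* ℂˣ) (η₁ η₂ : ↥(normOneUnits (conjLocal L (IsCMField.complexConj L) v)) →* ℂˣ),
        IsQuadraticCharExtension (conjLocal L (IsCMField.complexConj L) v) μ →
        Continuous (fun x => ((μ x : ℂˣ) : ℂ)) → Continuous (fun x => ((η₁ x : ℂˣ) : ℂ)) → Continuous (fun x => ((η₂ x : ℂˣ) : ℂ)) →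
        ¬ DecaysOnSplitTorus L v (cmWeylTorusCharPair L v
        (η₁.comp (quotConj (conjLocal L (IsCMField.complexConj L) v) (conjLocal_conjLocal_cm L v)) * μ * halfModulusChar (LocalRing L v)) η₂)) :
    KeysCaseTwo L := by
  intro v hns μ η₁ η₂ hμ hμc h1c h2c _i1 _i2 μZ _i3
  have H2 := h2 v hns μ η₁ η₂ hμ hμc h1c h2c (h1 v hns μ η₁ η₂ hμ hμc h1c h2c)
  cases H2 with
  | intro πs H2' =>
    cases H2' with
    | intro πn H3 =>
      -- both labelled classes are admissible: constituents of the admissible `i_G(χ_ξ)` (★ Iwasawa at every `v`)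
      have hadm := F0P3XiUnramNonsplitInstance.isAdmissible_cmPrincipalSeries L v (cmXiTorusChar L v μ η₁ η₂)
      have hπs : πs.IsAdmissible := isAdmissible_of_isConstituentOf ((H3.2.1 πs).2 (Or.inr rfl)) hadm
      have hπn : πn.IsAdmissible := isAdmissible_of_isConstituentOf ((H3.2.1 πn).2 (Or.inl rfl)) hadm
      have hs : πs.IsSquareIntegrable μZ :=
        (@h3 v hns _i1 _i2 μZ _i3 πs _ hπs H3.2.2.1).2 (h4 v hns μ η₁ η₂ hμ hμc h1c h2c)
      have hn : ¬ πn.IsSquareIntegrable μZ := fun hsq =>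
        h5 v hns μ η₁ η₂ hμ hμc h1c h2c ((@h3 v hns _i1 _i2 μZ _i3 πn _ hπn H3.2.2.2).1 hsq)
      exact ⟨πs, πn, H3.1, H3.2.1, hs, hn⟩

/-- **NF1 at the stubs of THIS file** (ED. v5: what the row `KeysCaseTwo` reads when S2 (p02), G3 (A-p01), N1, N3, N5′ close: the two letters BY NAME N4 = S1
[Keys1984 §7 Thm (2)] and N5 [Casselman1995 Thm 4.4.6]). [cite: Rogawski1990, §12.2 (2) pp. 173–174] -/
theorem keysCaseTwo_holds : KeysCaseTwo L :=
  keysCaseTwo_of_stubs L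
    (stub_keysCaseTwoReducible L)
    (fun v hns μ η₁ η₂ hμ hμc h1c h2c hred => stub_labelledPair_of_reducible L v (stub_jacquetFiltration L) (stub_lengthLeTwo L)
      (stub_casselmanCriterion L) (stub_subrepSquareIntegrable L) hns μ η₁ η₂ hμ hμc h1c h2c hred)
    (fun v hns _ _ μZ _ c θ hc hθ => isSquareIntegrable_iff_decays L v (stub_casselmanCriterion L) hns
      (fun V _ _ π _ hπ => stub_centralCharUnitary L v hns V π hπ) μZ c θ hc hθ)
    (fun v hns μ η₁ η₂ hμ hμc h1c h2c => stub_decays_xi L v hns μ η₁ η₂ hμ hμc h1c h2c)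
    (fun v hns μ η₁ η₂ hμ hμc h1c h2c => stub_not_decays_wxi L v hns μ η₁ η₂ hμ hμc h1c h2c)

/-! ## §3 The closed form for the registry: all CM fields at once (= the telescope of `stub_Keys` of the K9β closer) -/

/-- **NF1 over ALL CM fields** — `∀ L, KeysCaseTwo L`, character-for-character the type of `stub_Keys` (ED. 4 §C of `Lines/F0_U3LettersRung1.lean`); the
closed `Prop` a skeleton is REGISTERED against. [cite: Rogawski1990, §12.2 (2) pp. 173–174] -/
def KeysCaseTwoClosed : Prop :=
  ∀ (L : Type) [Field L] [NumberField L] [IsCMField L], KeysCaseTwo L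

/-- **REGISTERED HEAD**: the closed NF1 at the stubs of this file (ED. v5 cut; registered ED. 1∕2) — `sorry`-free itself; axioms TRIO + `sorryAx` exactly until the stubs close
(N4 = S1 and N5 then remain as the two cited `sorryAx` sources, honestly labelled). [cite: Rogawski1990, §12.2 (2) pp. 173–174] [cite: Keys1984, §7 Theorem (2)]
[cite: Casselman1995, Thm 4.4.6] -/
theorem keysCaseTwo_closed : KeysCaseTwoClosed :=
  fun L _ _ _ => keysCaseTwo_holds L

end Summit.HodgeConjecture.HodgeConjecture.Cruxes.H413.F0P3KeysCaseTwoPaydown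

end
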